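/-
Copyright: public-audit package `pub-balaban` (b2b-balaban), seat pv09-g9. Released under Apache 2.0 like Mathlib.
-/
import Literature.MathematicalPhysics.QuantumFieldTheory.Balaban1983to89.B6Lemma24TorusWitness

/-!
# B6 Lemma 2.4 / (2.153) on the torus — the pure-gauge modes: each hypothesis of the typed nodes is load-bearing

CITATION HEADER
  module   : Literature.MathematicalPhysics.QuantumFieldTheory.Balaban1983to89.B6Lemma24TorusGaugeModes
  package  : pub-balaban (surge node prover #09 gen 9 = b2b-balaban-pv09-g9; journal claim G-B6-2153-TORUS-MODES;
             v1.1 §7 = gen 10, b2b-balaban-pv09-g10, claim G-B6-2153-TORUS-MODES-V11)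
  paper    : [Balaban1984PropagatorsII] T. Balaban, "Propagators and renormalization transformations for lattice
             gauge theories. II", Commun. Math. Phys. 96 (1984) 223–250.
  printed  : TWO sentences are quoted, both read as images on the page renders this session and both already
             XREAD-certified verbatim in the headers of `B6Lemma24Printed` / `B6Lemma24Torus` (same lineage):
             p. 245 [PDF 23], Lemma 2.4: «Lemma 2.4. Let a set Λ ⊂ Z^d be a sum of blocks, Λ = B(Λ′). We denote by
             Λ also a set of bonds b such that at least one of the end-points b₋, b₊ belongs to Λ. Let B be a
             configuration defined on Λ and satisfying the condition (2.121): B(Γ_{y,x}) = 0 for x ∈ B(y), y ∈ Λ′.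
             We put B = 0 outside Λ. Then the following inequality holds
               L^{d−2} Σ_{c∈Λ′} |(Q₁B)(c)|² + Σ_p |(∂₁B)(p)|² ≥ (1/(12d²)) L^{−d−1} ‖B‖².   (2.128)»
             p. 249 [PDF 27]: «Using (2.118) and (2.128) we get ⟨B, Δ_k B⟩ ≥ (γ₀/(12d²)) L^{−d−1} ‖B‖², or
               Δ_k ≥ (γ₀/(12d²)) L^{−d−1}   (2.153)
             on the subspace of B satisfying: QB = 0, B(Γ_{y,x}) = 0 for x ∈ B(y).»
  status   : kernel-checked, 0 sorry; EVERY declaration is [folklore] (elementary lattice calculus ABOUT the typed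
             torus nodes `B6Lemma24Torus.lemma24_torus` / `lowerBound2153_torus_printed`); NOTHING printed is
             asserted, no hypothesis carries a citation; the `[cite: …]` tags below are LOCATORS of the displays
             whose typed forms are instantiated.

## What is printed, and what the typed nodes say

(2.128) is stated for configurations *"satisfying the condition (2.121)"* and carries the term
`L^{d−2} Σ_c |(Q₁B)(c)|²`; (2.153) is stated *"on the subspace of B satisfying: QB = 0, B(Γ_{y,x}) = 0"*.  The typed
torus nodes of this package follow the print literally: `B6Lemma24Torus.lemma24_torus` has the hypotheses
(periodicity = "B is a configuration on T") and (2.121) on the blocks of T′ and the conclusion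
`(1/(12d²)) L^{−(d+1)} ‖B‖²_T ≤ L^{d−2} Σ_{c∈T′}|(Q₁B)(c)|² + Σ_{p⊂T}|(∂₁B)(p)|²`;
`B6Lemma24Torus.lowerBound2153_torus_printed` has, for any functional `form` with (2.118)
`γ₀ Σ_p|(∂₁B)(p)|² ≤ form B`, the hypotheses "QB = 0" (`q1 = 0` at every coarse bond of T) and (2.121) in the
printed contour form, and the conclusion `(γ₀/(12d²)) L^{−(d+1)} ‖B‖²_T ≤ form B`.  The sibling leaf
`B6Lemma24TorusWitness` (same seat) proved that the constrained subspace is NOT {0} for L ≥ 2 (the nodes are not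
vacuous).  This leaf proves the complementary structural fact: **none of the constraints / terms can be dropped** —
each of the following strengthenings of the typed statements is FALSE on every torus of the stated kind, refuted by
an explicit PURE-GAUGE MODE `B = dλ` (a lattice gradient, `grad`), for which `∂₁B = 0` identically (`curl_grad`,
the lattice identity d∘d = 0):

* `lemma24_torus_false_without_gauge` — (2.128) on T WITHOUT (2.121) fails (even granting QB = 0): the mode
  `modeC L = d(𝟙_{LZ^d})` (gradient of the indicator of the coarse lattice) is periodic, has (Q₁B)(c) = 0 at EVERY
  coarse bond (`q1_modeC`) and ∂₁B = 0, but ‖B‖²_T > 0 (it is −1 on the bond ⟨0, e_μ⟩, L ≥ 2); it violates (2.121)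
  (`modeC_not_treeGauge`), which is exactly what excludes it in print.
* `lemma24_torus_false_without_q1` — (2.128) on T WITHOUT the Q₁-term fails (granting (2.121)): the mode
  `modeS M L i₀ = d(𝟙{x : M_{i₀} ∣ (corner of the block of x)_{i₀}})` (gradient of the indicator of one periodic
  column of blocks; needs two blocks in direction i₀, `L < M_{i₀}` — a side condition that v1.1 §7 removes with a
  non-exact flat mode, see below) is constant on blocks, hence 0 on every bond
  inside a block and in particular in the gauge (2.121) in tree AND contour form (`modeS_treeBonds`,
  `contourSum_modeS`), has ∂₁B = 0 and ‖B‖²_T > 0; its Q₁-average at the face ⟨0, Le_{i₀}⟩ is −L^{−1} ≠ 0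
  (`q1_modeS_face`), which is exactly the term that saves (2.128) for it.
* `lemma24_torus_false_without_d1` — (2.128) on T WITHOUT the ∂₁-term fails (granting (2.121) and QB = 0): the
  sibling's witness `B6Lemma24TorusWitness.wit` has QB = 0, (2.121), ‖B‖²_T > 0 (d ≥ 2, L ≥ 2).
* `lowerBound2153_torus_false_without_gauge`, `lowerBound2153_torus_false_without_QB` — the two constraints of
  the printed (2.153) sentence are each load-bearing for the typed node: with the admissible functional
  `form B := γ₀ Σ_{p⊂T}|(∂₁B)(p)|²` (which satisfies the typed (2.118) hypothesis with equality) and γ₀ > 0, dropping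
  "B(Γ_{y,x}) = 0" is refuted by `modeC`, dropping "QB = 0" by `modeS`.

So, together with `B6Lemma24TorusWitness`: the typed (2.128)/(2.153) torus nodes are non-vacuous AND minimal in
their hypotheses — the constraints *"QB = 0, B(Γ_{y,x}) = 0"* remove precisely such pure-gauge directions, on which
every functional saturating (2.118) vanishes while ‖B‖² does not.

HONEST SCOPE.  Elementary and [folklore]; it says nothing about the VALUE of the constants, nothing about (2.118)
itself (a hypothesis of the typed node, typed elsewhere in the package), and nothing about Δ_k beyond the typed
`form` interface.  NOT an audit finding against [B6] (the print states exactly these hypotheses); NOT summit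
progress.

v1.1 (APPEND-ONLY: every declaration of v1 is unchanged in statement and proof; §7 is ADDED; in this header only
this paragraph, one clause in the `modeS` bullet above and the package line changed).  The cross-read of v1 by a
reader outside this lineage (b2b-balaban-pv04-g18, recorded in the cell as GAPS C-pv04g18-1, INFO I1, with a
kernel-checked probe) observed that the side condition `L < M i₀` of `lemma24_torus_false_without_q1` and
`lowerBound2153_torus_false_without_QB` is an artefact of the GRADIENT witness `modeS` (a block-constant potential
is constant on a torus with one block in direction i₀) and exhibited the NON-EXACT flat "face-crossing" mode
`modeH L i₀` := 1 on the bonds ⟨x, x + e_{i₀}⟩ with `L ∣ x_{i₀} + 1`, 0 elsewhere — holonomy `M_{i₀}/L ≠ 0` around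
the i₀-cycle, so not a gradient when `M_{i₀} = L`; it is M-periodic whenever `L ∣ M_i`, vanishes on EVERY tree
bond (a crossing bond leaves its block, so (2.121) holds in tree AND contour form), is curl-free (∂₁ = 0) and has
the value 1 at the bond `(zW L i₀, i₀)`, hence ‖·‖²_T > 0.  §7 adopts it (the reader's proofs, adapted to this
namespace and credited in the docstrings): `lemma24_torus_false_without_q1_allTori` and
`lowerBound2153_torus_false_without_QB_allTori` refute the same two strengthenings on EVERY torus — any `L ≥ 1`,
any periods with `L ∣ M_i`, including one block per direction (`M = L`) — and `oneBlockTorus_without_q1` records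
the instance d = 4, L = 2, M ≡ 2 that v1 did not cover.  v1's two theorems stay (true as typed; in content now the
special case `L < M i₀`).  Still all [folklore], nothing printed asserted, no new quotation.
RECORDS: GAPS C-pv09g9-14 (v1), C-pv04g18-1 (cross-read of v1), C-pv09g10-2 (v1.1).
-/

namespace Literature.MathematicalPhysics.QuantumFieldTheory.Balaban1983to89.B6Lemma24TorusGaugeModes

open Finset
open B6Elimination (mem_block corner corner_apply corner_eq_of_mem_block corner_eq_self_of_dvd card_block)
open B6BondElimination (unitVec unitVec_apply add_unitVec_apply add_smul_unitVec_apply treeBonds mem_treeBonds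
  contour_subset_treeBonds add_unitVec_mem_block)
open B6TreeGaugePoincare (Cfg curl)
open B6Lemma24PrintedShape (segSum q1 contourSum)
open B6Lemma24Torus (IsPeriod IsPeriodic pbox mem_pbox coarseSites mem_coarseSites coarseSites_dvd faces mem_faces
  bondsT mem_bondsT plaqT mem_plaqT normSqT d1SqT q1SqT)
open B6Lemma24TorusWitness (not_dvd_one wit isPeriodic_wit wit_treeBonds q1_wit q1SqT_wit normSqT_wit_pos zW
  zW_apply zW_mem_pbox dir_lt)

noncomputable section

variable {d : ℕ} {L : ℕ}

/-! ## §1  Lattice gradients (pure-gauge modes): d∘d = 0 and telescoping -/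

/-- The lattice gradient of a site function λ: (dλ)(⟨x, x + e_ν⟩) = λ(x + e_ν) − λ(x) — an infinitesimal gauge
transformation of the zero configuration ("pure gauge"). [folklore] -/
def grad (lam : (Fin d → ℤ) → ℝ) : Cfg d := fun b => lam (b.1 + unitVec b.2) - lam b.1

/-- Evaluation of the gradient. [folklore] -/
@[simp] theorem grad_apply (lam : (Fin d → ℤ) → ℝ) (x : Fin d → ℤ) (ν : Fin d) :
    grad lam (x, ν) = lam (x + unitVec ν) - lam x := rfl

/-- **d∘d = 0**: a gradient has zero plaquette curl (`B6TreeGaugePoincare.curl`), identically. [folklore] -/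
theorem curl_grad (lam : (Fin d → ℤ) → ℝ) (z : Fin d → ℤ) (j μ : Fin d) : curl (grad lam) z j μ = 0 := by
  rw [curl, grad_apply, grad_apply, grad_apply, grad_apply, add_right_comm z (unitVec μ) (unitVec j)]
  ring

/-- Hence Σ_{p⊂T}|(∂₁ dλ)(p)|² = 0 on every torus (`B6Lemma24Torus.d1SqT`). [folklore] -/
theorem d1SqT_grad (M : Fin d → ℕ) (lam : (Fin d → ℤ) → ℝ) : d1SqT M (grad lam) = 0 := by
  unfold d1SqT
  exact sum_eq_zero fun p _ => by rw [curl_grad]; ring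

/-- x + s e_μ + e_μ = x + (s+1) e_μ. [folklore] -/
theorem add_smul_add_unitVec (x : Fin d → ℤ) (μ : Fin d) (s : ℕ) :
    x + (s : ℤ) • unitVec μ + unitVec μ = x + ((s + 1 : ℕ) : ℤ) • unitVec μ := by
  funext i
  rw [add_unitVec_apply, add_smul_unitVec_apply, add_smul_unitVec_apply, Nat.cast_succ]
  split_ifs <;> ring

/-- x + 0 • e_μ = x. [folklore] -/
theorem add_zero_smul_unitVec (x : Fin d → ℤ) (μ : Fin d) : x + ((0 : ℕ) : ℤ) • unitVec μ = x := by
  funext i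
  rw [add_smul_unitVec_apply, Nat.cast_zero]
  split_ifs <;> ring

/-- **Telescoping**: the straight segment sum of length L of a gradient (`B6Lemma24PrintedShape.segSum`, the
summand of (Q₁B)(c) in (2.125)) is λ(x + Le_μ) − λ(x). [folklore] -/
theorem segSum_grad (lam : (Fin d → ℤ) → ℝ) (x : Fin d → ℤ) (μ : Fin d) :
    segSum L (grad lam) x μ = lam (x + (L : ℤ) • unitVec μ) - lam x := by
  have h : ∑ s ∈ range L, (lam (x + ((s + 1 : ℕ) : ℤ) • unitVec μ) - lam (x + (s : ℤ) • unitVec μ)) =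
      lam (x + (L : ℤ) • unitVec μ) - lam (x + ((0 : ℕ) : ℤ) • unitVec μ) :=
    sum_range_sub (fun n : ℕ => lam (x + (n : ℤ) • unitVec μ)) L
  rw [add_zero_smul_unitVec] at h
  unfold segSum
  rw [← h]
  exact sum_congr rfl fun s _ => by rw [grad_apply, add_smul_add_unitVec]

/-- (Q₁ dλ)(c) = Σ_{x∈B(c₋)} L^{−(d+1)} (λ(x + Le_μ) − λ(x)) (`B6Lemma24PrintedShape.q1`, (2.125) verbatim shape).
[cite: Balaban1984PropagatorsII, (2.125) p.245 (locator; typed `q1`)] -/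
theorem q1_grad (lam : (Fin d → ℤ) → ℝ) (c : (Fin d → ℤ) × Fin d) :
    q1 L (grad lam) c =
      ∑ x ∈ B6Elimination.block L c.1, ((L : ℝ) ^ (d + 1))⁻¹ * (lam (x + (L : ℤ) • unitVec c.2) - lam x) := by
  unfold q1
  exact sum_congr rfl fun x _ => by rw [segSum_grad]

/-- A gradient of an M-periodic site function is an M-periodic configuration (`B6Lemma24Torus.IsPeriodic`), i.e. a
configuration on the torus T. [folklore] -/
theorem isPeriodic_grad {M : Fin d → ℕ} {lam : (Fin d → ℤ) → ℝ}
    (h : ∀ x v : Fin d → ℤ, IsPeriod M v → lam (x + v) = lam x) : IsPeriodic M (grad lam) := by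
  intro x v ν hv
  rw [grad_apply, grad_apply, add_right_comm x v (unitVec ν), h _ _ hv, h _ _ hv]

/-- ‖B‖²_T > 0 as soon as one bond of T carries a non-zero value. [folklore] -/
theorem normSqT_pos_of_bond {M : Fin d → ℕ} {B : Cfg d} {b : (Fin d → ℤ) × Fin d} (hb : b ∈ bondsT M)
    (h : B b ≠ 0) : 0 < normSqT M B := by
  have h1 : B b ^ 2 ≤ ∑ b ∈ bondsT M, B b ^ 2 :=
    single_le_sum (f := fun b => B b ^ 2) (fun _ _ => sq_nonneg _) hb
  have h2 : 0 < B b ^ 2 := by positivity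
  unfold normSqT
  linarith

/-- The prefactor (γ/(12d²)) L^{−(d+1)} of (2.128)/(2.153) is positive (d, L ≥ 1, γ > 0). [folklore] -/
theorem prefactor_pos (hd : 0 < d) (hL : 0 < L) {γ : ℝ} (hγ : 0 < γ) :
    0 < γ / (12 * (d : ℝ) ^ 2) * (L : ℝ) ^ (-((d : ℝ) + 1)) := by
  have hd0 : (0 : ℝ) < d := by exact_mod_cast hd
  have hLr : (0 : ℝ) < L := by exact_mod_cast hL
  have h1 : (0 : ℝ) < (L : ℝ) ^ (-((d : ℝ) + 1)) := Real.rpow_pos_of_pos hLr _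
  positivity

/-- The origin lies in the box Π[0, M_μ) (M_μ ≥ 1). [folklore] -/
theorem zero_mem_pbox {M : Fin d → ℕ} (hM : ∀ i, 0 < M i) : (0 : Fin d → ℤ) ∈ pbox M :=
  mem_pbox.2 fun i => ⟨le_rfl, show (0 : ℤ) < (M i : ℤ) by exact_mod_cast hM i⟩

/-- The origin is a coarse site of T. [folklore] -/
theorem zero_mem_coarseSites {M : Fin d → ℕ} (hM : ∀ i, 0 < M i) : (0 : Fin d → ℤ) ∈ coarseSites L M :=
  mem_coarseSites.2 ⟨zero_mem_pbox hM, fun _ => dvd_zero _⟩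

/-! ## §2  The coarse-lattice mode `modeC = d 𝟙_{LZ^d}`: QB = 0 and ∂₁B = 0, but (2.121) fails and ‖B‖² > 0 -/

/-- The indicator of the coarse lattice LZ^d (the block corners). [folklore] -/
def lamC (L : ℕ) (x : Fin d → ℤ) : ℝ := if ∀ i, (L : ℤ) ∣ x i then 1 else 0

/-- 𝟙_{LZ^d} is invariant under translations by LZ^d. [folklore] -/
theorem lamC_add_of_dvd {x v : Fin d → ℤ} (hv : ∀ i, (L : ℤ) ∣ v i) : lamC L (x + v) = lamC L x := by
  unfold lamC
  by_cases hx : ∀ i, (L : ℤ) ∣ x i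
  · rw [if_pos hx, if_pos (fun i => by rw [Pi.add_apply]; exact dvd_add (hx i) (hv i))]
  · rw [if_neg hx, if_neg (fun h => hx fun i => by
      have hi := h i
      rw [Pi.add_apply] at hi
      exact (dvd_add_left (hv i)).1 hi)]

/-- 𝟙_{LZ^d}(0) = 1. [folklore] -/
theorem lamC_zero : lamC L (0 : Fin d → ℤ) = 1 := by
  unfold lamC
  rw [if_pos]
  exact fun i => dvd_zero _

/-- 𝟙_{LZ^d}(e_μ) = 0 for L ≥ 2. [folklore] -/
theorem lamC_unitVec (hL : 2 ≤ L) (μ : Fin d) : lamC L (unitVec μ) = 0 := by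
  unfold lamC
  rw [if_neg (fun h => not_dvd_one hL (by simpa [unitVec_apply] using h μ))]

/-- **The coarse mode** B = d 𝟙_{LZ^d}. [folklore] -/
def modeC (L : ℕ) : Cfg d := grad (lamC L)

/-- It is a configuration on every torus T with L ∣ M_μ. [folklore] -/
theorem isPeriodic_modeC {M : Fin d → ℕ} (hLM : ∀ i, L ∣ M i) : IsPeriodic M (modeC (d := d) L) :=
  isPeriodic_grad fun _ _ hv => lamC_add_of_dvd fun i => (Int.natCast_dvd_natCast.2 (hLM i)).trans (hv i)

/-- ∂₁(modeC) = 0 at every plaquette. [folklore] -/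
theorem curl_modeC (z : Fin d → ℤ) (j μ : Fin d) : curl (modeC (d := d) L) z j μ = 0 := curl_grad _ z j μ

/-- Σ_{p⊂T}|∂₁ modeC|² = 0. [folklore] -/
theorem d1SqT_modeC (M : Fin d → ℕ) : d1SqT M (modeC (d := d) L) = 0 := d1SqT_grad M _

/-- **QB = 0**: (Q₁ modeC)(c) = 0 at EVERY coarse bond c — each segment sum telescopes to
𝟙_{LZ^d}(x + Le_μ) − 𝟙_{LZ^d}(x) = 0. [cite: Balaban1984PropagatorsII, (2.125) p.245, (2.153) p.249 (locators; typed `q1`)] -/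
theorem q1_modeC (c : (Fin d → ℤ) × Fin d) : q1 L (modeC (d := d) L) c = 0 := by
  rw [modeC, q1_grad]
  refine sum_eq_zero fun x _ => ?_
  rw [lamC_add_of_dvd (fun i => ?_), sub_self, mul_zero]
  rw [Pi.smul_apply, smul_eq_mul]
  exact dvd_mul_right _ _

/-- Σ_{c∈T′}|(Q₁ modeC)(c)|² = 0. [folklore] -/
theorem q1SqT_modeC (M : Fin d → ℕ) : q1SqT L M (modeC (d := d) L) = 0 := by
  unfold q1SqT
  exact sum_eq_zero fun c _ => by rw [q1_modeC]; ring

/-- modeC(⟨0, e_μ⟩) = −1 (L ≥ 2). [folklore] -/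
theorem modeC_origin (hL : 2 ≤ L) (μ : Fin d) : modeC L ((0 : Fin d → ℤ), μ) = -1 := by
  rw [modeC, grad_apply, zero_add, lamC_unitVec hL, lamC_zero]
  ring

/-- **‖modeC‖²_T > 0** on every torus (L ≥ 2, d ≥ 1). [folklore] -/
theorem normSqT_modeC_pos (hL : 2 ≤ L) {M : Fin d → ℕ} (hM : ∀ i, 0 < M i) (μ : Fin d) :
    0 < normSqT M (modeC L) :=
  normSqT_pos_of_bond (b := ((0 : Fin d → ℤ), μ)) (mem_bondsT.2 (zero_mem_pbox hM))
    (by rw [modeC_origin hL μ]; norm_num)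

/-- **modeC violates (2.121)**: it is −1 on the first tree bond ⟨0, e_1⟩ of the block B(0), 0 ∈ T′ — the gauge
condition is exactly what removes this mode in print. [cite: Balaban1984PropagatorsII, (2.121) p.244 (locator; typed `treeBonds`)] -/
theorem modeC_not_treeGauge (hd : 0 < d) (hL : 2 ≤ L) {M : Fin d → ℕ} (hM : ∀ i, 0 < M i) :
    ¬ ∀ y ∈ coarseSites L M, ∀ b ∈ treeBonds L y, modeC L b = 0 := by
  intro h
  have hb : ((0 : Fin d → ℤ), (⟨0, hd⟩ : Fin d)) ∈ treeBonds L 0 := by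
    refine mem_treeBonds.2 ⟨mem_block.2 fun i => ⟨le_rfl, ?_⟩, fun i hi => ?_, ?_⟩
    · show (0 : ℤ) < 0 + (L : ℤ)
      omega
    · exact absurd (Fin.lt_def.1 hi) (Nat.not_lt_zero _)
    · show (0 : ℤ) + 1 < 0 + (L : ℤ)
      omega
  have h0 := h 0 (zero_mem_coarseSites hM) _ hb
  rw [modeC_origin hL] at h0
  norm_num at h0

/-- **(2.128) on the torus is FALSE without the gauge condition (2.121)** — even for configurations with
(Q₁B)(c) = 0 at every coarse bond: for every d ≥ 1, L ≥ 2 and every torus (M_μ ≥ 1, L ∣ M_μ) the coarse mode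
refutes `∀ B on T, QB = 0 → (1/(12d²))L^{−(d+1)}‖B‖²_T ≤ L^{d−2}Σ_c|(Q₁B)(c)|² + Σ_p|(∂₁B)(p)|²`.  (The typed node
`B6Lemma24Torus.lemma24_torus` carries (2.121) as the hypothesis `hT`, as printed.)
[cite: Balaban1984PropagatorsII, Lemma 2.4 (2.128) p.245 (locator; typed `lemma24_torus`)] -/
theorem lemma24_torus_false_without_gauge (hd : 0 < d) (hL : 2 ≤ L) {M : Fin d → ℕ} (hM : ∀ i, 0 < M i)
    (hLM : ∀ i, L ∣ M i) :
    ¬ ∀ B : Cfg d, IsPeriodic M B → (∀ c ∈ faces L M, q1 L B c = 0) →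
      1 / (12 * (d : ℝ) ^ 2) * (L : ℝ) ^ (-((d : ℝ) + 1)) * normSqT M B ≤
        (L : ℝ) ^ ((d : ℝ) - 2) * q1SqT L M B + d1SqT M B := by
  intro h
  have h1 := h (modeC L) (isPeriodic_modeC hLM) (fun c _ => q1_modeC c)
  rw [q1SqT_modeC, d1SqT_modeC, mul_zero, add_zero] at h1
  have h2 := mul_pos (prefactor_pos (d := d) (L := L) hd (by omega) one_pos) (normSqT_modeC_pos hL hM ⟨0, hd⟩)
  linarith

/-! ## §3  The block-column mode `modeS`: (2.121) holds and ∂₁B = 0, but QB ≠ 0 and ‖B‖² > 0 -/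

/-- The corner map is LZ^d-equivariant, coordinatewise. [folklore] -/
theorem corner_add_of_dvd (hL : 0 < L) (x v : Fin d → ℤ) (i : Fin d) (hv : (L : ℤ) ∣ v i) :
    corner L (x + v) i = corner L x i + v i := by
  obtain ⟨k, hk⟩ := hv
  have hL0 : (L : ℤ) ≠ 0 := by exact_mod_cast hL.ne'
  rw [corner_apply, corner_apply, Pi.add_apply, hk, Int.add_mul_ediv_left _ _ hL0]
  ring

/-- The corner of a point of the block B(y), y ∈ LZ^d, is y. [folklore] -/
theorem corner_of_mem_block (hL : 0 < L) {y x : Fin d → ℤ} (hy : ∀ i, (L : ℤ) ∣ y i)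
    (hx : x ∈ B6Elimination.block L y) : corner L x = y := by
  have h := hx
  rw [← corner_eq_self_of_dvd y hy] at h
  rw [corner_eq_of_mem_block hL h, corner_eq_self_of_dvd y hy]

/-- The indicator of the periodic column of blocks {x : M_{i₀} ∣ (corner of x)_{i₀}} (the blocks B(y), y ∈ LZ^d,
with y_{i₀} ∈ M_{i₀}Z). [folklore] -/
def lamS (M : Fin d → ℕ) (L : ℕ) (i₀ : Fin d) (x : Fin d → ℤ) : ℝ :=
  if (M i₀ : ℤ) ∣ corner L x i₀ then 1 else 0

/-- **The block-column mode** B = d 𝟙_{column}. [folklore] -/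
def modeS (M : Fin d → ℕ) (L : ℕ) (i₀ : Fin d) : Cfg d := grad (lamS M L i₀)

/-- The column indicator is M-periodic (L ∣ M_μ). [folklore] -/
theorem lamS_add_period (hL : 0 < L) {M : Fin d → ℕ} (hLM : ∀ i, L ∣ M i) (i₀ : Fin d) (x v : Fin d → ℤ)
    (hv : IsPeriod M v) : lamS M L i₀ (x + v) = lamS M L i₀ x := by
  have hLv : (L : ℤ) ∣ v i₀ := (Int.natCast_dvd_natCast.2 (hLM i₀)).trans (hv i₀)
  unfold lamS
  simp only [corner_add_of_dvd hL x v i₀ hLv, dvd_add_left (hv i₀)]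

/-- modeS is a configuration on the torus T. [folklore] -/
theorem isPeriodic_modeS (hL : 0 < L) {M : Fin d → ℕ} (hLM : ∀ i, L ∣ M i) (i₀ : Fin d) :
    IsPeriodic M (modeS M L i₀) :=
  isPeriodic_grad fun x v hv => lamS_add_period hL hLM i₀ x v hv

/-- The column indicator is constant on every block B(y), y ∈ LZ^d. [folklore] -/
theorem lamS_of_mem_block (hL : 0 < L) (M : Fin d → ℕ) (i₀ : Fin d) {y x : Fin d → ℤ}
    (hy : ∀ i, (L : ℤ) ∣ y i) (hx : x ∈ B6Elimination.block L y) :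
    lamS M L i₀ x = if (M i₀ : ℤ) ∣ y i₀ then 1 else 0 := by
  unfold lamS
  rw [corner_of_mem_block hL hy hx]

/-- **(2.121), tree form**: modeS vanishes on every bond of the axial tree of every block B(y), y ∈ LZ^d (indeed on
every bond inside a block). [cite: Balaban1984PropagatorsII, (2.121) p.244 (locator; typed `treeBonds`)] -/
theorem modeS_treeBonds (hL : 0 < L) (M : Fin d → ℕ) (i₀ : Fin d) {y : Fin d → ℤ} (hy : ∀ i, (L : ℤ) ∣ y i) :
    ∀ b ∈ treeBonds L y, modeS M L i₀ b = 0 := by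
  intro b hb
  obtain ⟨h1, -, h3⟩ := mem_treeBonds.1 hb
  have h2 : b.1 + unitVec b.2 ∈ B6Elimination.block L y := add_unitVec_mem_block h1 h3
  show lamS M L i₀ (b.1 + unitVec b.2) - lamS M L i₀ b.1 = 0
  rw [lamS_of_mem_block hL M i₀ hy h2, lamS_of_mem_block hL M i₀ hy h1, sub_self]

/-- **(2.121), printed contour form**: modeS(Γ_{y,x}) = 0 for x ∈ B(y), y ∈ LZ^d.
[cite: Balaban1984PropagatorsII, (2.121) p.244, (2.153) p.249 (locators; typed `contourSum`)] -/
theorem contourSum_modeS (hL : 0 < L) (M : Fin d → ℕ) (i₀ : Fin d) {y : Fin d → ℤ} (hy : ∀ i, (L : ℤ) ∣ y i)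
    {x : Fin d → ℤ} (hx : x ∈ B6Elimination.block L y) : contourSum L (modeS M L i₀) y x = 0 := by
  unfold contourSum
  exact sum_eq_zero fun b hb => modeS_treeBonds hL M i₀ hy b (contour_subset_treeBonds hx hb)

/-- ∂₁(modeS) = 0 at every plaquette. [folklore] -/
theorem curl_modeS (M : Fin d → ℕ) (i₀ : Fin d) (z : Fin d → ℤ) (j μ : Fin d) :
    curl (modeS M L i₀) z j μ = 0 := curl_grad _ z j μ

/-- Σ_{p⊂T}|∂₁ modeS|² = 0. [folklore] -/
theorem d1SqT_modeS (M : Fin d → ℕ) (i₀ : Fin d) : d1SqT M (modeS M L i₀) = 0 := d1SqT_grad M _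

/-- The corner of z = (L−1)e_{i₀} has i₀-coordinate 0. [folklore] -/
theorem corner_zW (hL : 1 ≤ L) (i₀ : Fin d) : corner L (zW L i₀) i₀ = 0 := by
  rw [corner_apply, zW_apply, if_pos rfl, Int.ediv_eq_zero_of_lt (by omega) (by omega), mul_zero]

/-- The corner of z + e_{i₀} = Le_{i₀} has i₀-coordinate L. [folklore] -/
theorem corner_zW_add (hL : 1 ≤ L) (i₀ : Fin d) : corner L (zW L i₀ + unitVec i₀) i₀ = L := by
  have hL0 : (L : ℤ) ≠ 0 := by exact_mod_cast (show L ≠ 0 by omega)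
  rw [corner_apply, add_unitVec_apply, zW_apply, if_pos rfl, if_pos rfl, sub_add_cancel, Int.ediv_self hL0,
    mul_one]

/-- The column indicator is 1 at z = (L−1)e_{i₀} (block B(0)). [folklore] -/
theorem lamS_zW (hL : 1 ≤ L) (M : Fin d → ℕ) (i₀ : Fin d) : lamS M L i₀ (zW L i₀) = 1 := by
  unfold lamS
  rw [corner_zW hL, if_pos (dvd_zero _)]

/-- … and 0 at z + e_{i₀} = Le_{i₀} (block B(Le_{i₀})) as soon as there are two blocks in direction i₀
(L < M_{i₀}; with L ∣ M_{i₀} this is M_{i₀} ≥ 2L). [folklore] -/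
theorem lamS_zW_add (hL : 1 ≤ L) {M : Fin d → ℕ} {i₀ : Fin d} (hLM₀ : L < M i₀) :
    lamS M L i₀ (zW L i₀ + unitVec i₀) = 0 := by
  unfold lamS
  rw [corner_zW_add hL, if_neg]
  intro h
  have h' := Nat.le_of_dvd (by omega) (Int.natCast_dvd_natCast.1 h)
  omega

/-- modeS(⟨(L−1)e_{i₀}, Le_{i₀}⟩) = −1. [folklore] -/
theorem modeS_marked (hL : 1 ≤ L) {M : Fin d → ℕ} {i₀ : Fin d} (hLM₀ : L < M i₀) :
    modeS M L i₀ (zW L i₀, i₀) = -1 := by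
  rw [modeS, grad_apply, lamS_zW_add hL hLM₀, lamS_zW hL]
  ring

/-- **‖modeS‖²_T > 0** (the marked bond is a bond of T). [folklore] -/
theorem normSqT_modeS_pos (hL : 1 ≤ L) {M : Fin d → ℕ} (hM : ∀ i, 0 < M i) (hLM : ∀ i, L ∣ M i) {i₀ : Fin d}
    (hLM₀ : L < M i₀) : 0 < normSqT M (modeS M L i₀) :=
  normSqT_pos_of_bond (b := (zW L i₀, i₀)) (mem_bondsT.2 (zW_mem_pbox hL hM hLM))
    (by rw [modeS_marked hL hLM₀]; norm_num)

/-- **QB ≠ 0 for modeS**: (Q₁ modeS)(⟨0, Le_{i₀}⟩) = −L^{−(d+1)}·L^d (= −1/L): every one of the L^d segment sums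
over B(0) telescopes to 𝟙(Le_{i₀}-column) − 𝟙(0-column) = 0 − 1. [cite: Balaban1984PropagatorsII, (2.125) p.245 (locator; typed `q1`)] -/
theorem q1_modeS_face (hL : 1 ≤ L) {M : Fin d → ℕ} {i₀ : Fin d} (hLM₀ : L < M i₀) :
    q1 L (modeS M L i₀) ((0 : Fin d → ℤ), i₀) = -(((L : ℝ) ^ (d + 1))⁻¹ * (L : ℝ) ^ d) := by
  rw [modeS, q1_grad]
  have hc : ∀ x ∈ B6Elimination.block L (0 : Fin d → ℤ),
      ((L : ℝ) ^ (d + 1))⁻¹ * (lamS M L i₀ (x + (L : ℤ) • unitVec i₀) - lamS M L i₀ x) =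
        -((L : ℝ) ^ (d + 1))⁻¹ := by
    intro x hx
    have h0 : corner L x = 0 := corner_of_mem_block hL (fun _ => dvd_zero _) hx
    have hdv : (L : ℤ) ∣ ((L : ℤ) • unitVec i₀) i₀ := by
      rw [Pi.smul_apply, smul_eq_mul]
      exact dvd_mul_right _ _
    have h1 : corner L (x + (L : ℤ) • unitVec i₀) i₀ = L := by
      rw [corner_add_of_dvd hL x _ i₀ hdv, h0]
      simp [unitVec_apply]
    have e0 : lamS M L i₀ x = 1 := by
      unfold lamS
      rw [h0, Pi.zero_apply, if_pos (dvd_zero _)]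
    have e1 : lamS M L i₀ (x + (L : ℤ) • unitVec i₀) = 0 := by
      unfold lamS
      rw [h1, if_neg]
      intro h
      have h' := Nat.le_of_dvd (by omega) (Int.natCast_dvd_natCast.1 h)
      omega
    rw [e0, e1]
    ring
  rw [sum_congr rfl hc, sum_const, card_block, nsmul_eq_mul]
  push_cast
  ring

/-- Hence (Q₁ modeS)(⟨0, Le_{i₀}⟩) < 0: modeS violates "QB = 0" — exactly the constraint that removes it in print.
[folklore] -/
theorem q1_modeS_face_neg (hL : 1 ≤ L) {M : Fin d → ℕ} {i₀ : Fin d} (hLM₀ : L < M i₀) :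
    q1 L (modeS M L i₀) ((0 : Fin d → ℤ), i₀) < 0 := by
  rw [q1_modeS_face hL hLM₀]
  have hLr : (0 : ℝ) < L := by exact_mod_cast (show 0 < L by omega)
  have h : (0 : ℝ) < ((L : ℝ) ^ (d + 1))⁻¹ * (L : ℝ) ^ d := by positivity
  linarith

/-- modeS does not satisfy "QB = 0" on T (the face ⟨0, Le_{i₀}⟩ is a coarse bond of T). [folklore] -/
theorem modeS_not_QZero (hL : 1 ≤ L) {M : Fin d → ℕ} (hM : ∀ i, 0 < M i) {i₀ : Fin d} (hLM₀ : L < M i₀) :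
    ¬ ∀ c ∈ faces L M, q1 L (modeS M L i₀) c = 0 := by
  intro h
  have h0 := h ((0 : Fin d → ℤ), i₀) (mem_faces.2 (zero_mem_coarseSites hM))
  exact (q1_modeS_face_neg hL hLM₀).ne h0

/-- **(2.128) on the torus is FALSE without the Q₁-term** — even in the gauge (2.121): for every L ≥ 1 and every
torus with L ∣ M_μ and two blocks in some direction (L < M_{i₀}) the block-column mode refutes
`∀ B on T, (2.121) → (1/(12d²))L^{−(d+1)}‖B‖²_T ≤ Σ_p|(∂₁B)(p)|²`.  (The typed node keeps the printed term
`L^{d−2} Σ_{c∈T′}|(Q₁B)(c)|²`.) [cite: Balaban1984PropagatorsII, Lemma 2.4 (2.128) p.245 (locator; typed `lemma24_torus`)] -/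
theorem lemma24_torus_false_without_q1 (hL : 1 ≤ L) {M : Fin d → ℕ} (hM : ∀ i, 0 < M i) (hLM : ∀ i, L ∣ M i)
    {i₀ : Fin d} (hLM₀ : L < M i₀) :
    ¬ ∀ B : Cfg d, IsPeriodic M B → (∀ y ∈ coarseSites L M, ∀ b ∈ treeBonds L y, B b = 0) →
      1 / (12 * (d : ℝ) ^ 2) * (L : ℝ) ^ (-((d : ℝ) + 1)) * normSqT M B ≤ d1SqT M B := by
  intro h
  have h1 := h (modeS M L i₀) (isPeriodic_modeS hL hLM i₀)
    (fun y hy => modeS_treeBonds hL M i₀ (coarseSites_dvd y hy))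
  rw [d1SqT_modeS] at h1
  have hd : 0 < d := lt_of_le_of_lt (Nat.zero_le _) i₀.isLt
  have h2 := mul_pos (prefactor_pos (d := d) (L := L) hd hL one_pos) (normSqT_modeS_pos hL hM hLM hLM₀)
  linarith

/-! ## §4  The ∂₁-term is load-bearing too (sibling witness) -/

/-- **(2.128) on the torus is FALSE without the ∂₁-term** — even in the gauge (2.121) and with QB = 0: for d ≥ 2,
L ≥ 2 and every torus (M_μ ≥ 1, L ∣ M_μ) the constrained witness `B6Lemma24TorusWitness.wit` (QB = 0, (2.121),
‖wit‖²_T > 0) refutes `∀ B on T, (2.121) → QB = 0 → (1/(12d²))L^{−(d+1)}‖B‖²_T ≤ L^{d−2}Σ_c|(Q₁B)(c)|²`.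
[cite: Balaban1984PropagatorsII, Lemma 2.4 (2.128) p.245 (locator; typed `lemma24_torus`)] -/
theorem lemma24_torus_false_without_d1 (hd : 2 ≤ d) (hL : 2 ≤ L) {M : Fin d → ℕ} (hM : ∀ i, 0 < M i)
    (hLM : ∀ i, L ∣ M i) :
    ¬ ∀ B : Cfg d, IsPeriodic M B → (∀ y ∈ coarseSites L M, ∀ b ∈ treeBonds L y, B b = 0) →
      (∀ c ∈ faces L M, q1 L B c = 0) →
      1 / (12 * (d : ℝ) ^ 2) * (L : ℝ) ^ (-((d : ℝ) + 1)) * normSqT M B ≤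
        (L : ℝ) ^ ((d : ℝ) - 2) * q1SqT L M B := by
  intro h
  have h01 := dir_lt hd
  have h1 := h (wit L ⟨0, by omega⟩ ⟨1, by omega⟩) (isPeriodic_wit hLM)
    (fun y hy => wit_treeBonds h01 (coarseSites_dvd y hy)) (fun c _ => q1_wit h01.ne c)
  rw [q1SqT_wit h01.ne, mul_zero] at h1
  have h2 := mul_pos (prefactor_pos (d := d) (L := L) (by omega) (by omega) one_pos) (normSqT_wit_pos h01.ne hL hM hLM)
  linarith

/-! ## §5  (2.153) in the printed shape: both constraints of the p. 249 sentence are load-bearing -/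

/-- **The typed (2.153) is FALSE without "B(Γ_{y,x}) = 0"**: for γ₀ > 0, d ≥ 1, L ≥ 2 and every torus, there is
a functional with the typed (2.118) hypothesis — `form B := γ₀ Σ_{p⊂T}|(∂₁B)(p)|²` itself — and a configuration on
T with QB = 0 (the coarse mode) at which `(γ₀/(12d²))L^{−(d+1)}‖B‖²_T ≤ form B` fails.
[cite: Balaban1984PropagatorsII, (2.153) p.249; (2.118) p.243 (locators; typed `lowerBound2153_torus_printed`)] -/
theorem lowerBound2153_torus_false_without_gauge (hd : 0 < d) (hL : 2 ≤ L) {M : Fin d → ℕ}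
    (hM : ∀ i, 0 < M i) (hLM : ∀ i, L ∣ M i) {γ₀ : ℝ} (hγ : 0 < γ₀) :
    ¬ ∀ form : Cfg d → ℝ, (∀ B : Cfg d, IsPeriodic M B → γ₀ * d1SqT M B ≤ form B) →
      ∀ B : Cfg d, IsPeriodic M B → (∀ c ∈ faces L M, q1 L B c = 0) →
        γ₀ / (12 * (d : ℝ) ^ 2) * (L : ℝ) ^ (-((d : ℝ) + 1)) * normSqT M B ≤ form B := by
  intro h
  have h1 := h (fun B => γ₀ * d1SqT M B) (fun B _ => le_rfl) (modeC L) (isPeriodic_modeC hLM)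
    (fun c _ => q1_modeC c)
  simp only [d1SqT_modeC, mul_zero] at h1
  have h2 := mul_pos (prefactor_pos (d := d) (L := L) hd (by omega) hγ) (normSqT_modeC_pos hL hM ⟨0, hd⟩)
  linarith

/-- **The typed (2.153) is FALSE without "QB = 0"**: for γ₀ > 0, L ≥ 1 and every torus with two blocks in some
direction, the same admissible functional and the block-column mode (which satisfies B(Γ_{y,x}) = 0 for every
x ∈ B(y), y ∈ T′) violate `(γ₀/(12d²))L^{−(d+1)}‖B‖²_T ≤ form B`.
[cite: Balaban1984PropagatorsII, (2.153) p.249; (2.118) p.243 (locators; typed `lowerBound2153_torus_printed`)] -/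
theorem lowerBound2153_torus_false_without_QB (hL : 1 ≤ L) {M : Fin d → ℕ} (hM : ∀ i, 0 < M i)
    (hLM : ∀ i, L ∣ M i) {i₀ : Fin d} (hLM₀ : L < M i₀) {γ₀ : ℝ} (hγ : 0 < γ₀) :
    ¬ ∀ form : Cfg d → ℝ, (∀ B : Cfg d, IsPeriodic M B → γ₀ * d1SqT M B ≤ form B) →
      ∀ B : Cfg d, IsPeriodic M B →
        (∀ y ∈ coarseSites L M, ∀ x ∈ B6Elimination.block L y, contourSum L B y x = 0) →
        γ₀ / (12 * (d : ℝ) ^ 2) * (L : ℝ) ^ (-((d : ℝ) + 1)) * normSqT M B ≤ form B := by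
  intro h
  have h1 := h (fun B => γ₀ * d1SqT M B) (fun B _ => le_rfl) (modeS M L i₀) (isPeriodic_modeS hL hLM i₀)
    (fun y hy x hx => contourSum_modeS hL M i₀ (coarseSites_dvd y hy) hx)
  simp only [d1SqT_modeS, mul_zero] at h1
  have hd : 0 < d := lt_of_le_of_lt (Nat.zero_le _) i₀.isLt
  have h2 := mul_pos (prefactor_pos (d := d) (L := L) hd hL hγ) (normSqT_modeS_pos hL hM hLM hLM₀)
  linarith

/-! ## §6  … while the typed nodes themselves hold at both modes (sanity, BY NAME) -/

/-- At the coarse mode the typed (2.128) (`lemma24_torus`) is not applicable ((2.121) fails) — and indeed its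
conclusion is false there; at the block-column mode it IS applicable and holds with the Q₁-term alone on the right:
(1/(12d²))L^{−(d+1)}‖modeS‖²_T ≤ L^{d−2} Σ_{c∈T′}|(Q₁ modeS)(c)|² (d ≥ 2). [cite: Balaban1984PropagatorsII, Lemma 2.4 (2.128) p.245 (typed torus version, instantiated)] -/
theorem lemma24_torus_at_modeS (hd : 2 ≤ d) (hL : 1 ≤ L) {M : Fin d → ℕ} (hM : ∀ i, 0 < M i)
    (hLM : ∀ i, L ∣ M i) (i₀ : Fin d) :
    1 / (12 * (d : ℝ) ^ 2) * (L : ℝ) ^ (-((d : ℝ) + 1)) * normSqT M (modeS M L i₀) ≤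
      (L : ℝ) ^ ((d : ℝ) - 2) * q1SqT L M (modeS M L i₀) := by
  have h := B6Lemma24Torus.lemma24_torus hd hL hM hLM (modeS M L i₀) (isPeriodic_modeS hL hLM i₀)
    (fun y hy => modeS_treeBonds hL M i₀ (coarseSites_dvd y hy))
  rwa [d1SqT_modeS, add_zero] at h

/-- In particular Σ_{c∈T′}|(Q₁ modeS)(c)|² > 0 follows from the typed Lemma 2.4 as well (two blocks in direction
i₀, d ≥ 2). [folklore] -/
theorem q1SqT_modeS_pos (hd : 2 ≤ d) (hL : 1 ≤ L) {M : Fin d → ℕ} (hM : ∀ i, 0 < M i) (hLM : ∀ i, L ∣ M i)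
    {i₀ : Fin d} (hLM₀ : L < M i₀) : 0 < q1SqT L M (modeS M L i₀) := by
  have h := lemma24_torus_at_modeS hd hL hM hLM i₀
  have h2 := mul_pos (prefactor_pos (d := d) (L := L) (by omega) hL one_pos) (normSqT_modeS_pos hL hM hLM hLM₀)
  have hLr : (0 : ℝ) < (L : ℝ) ^ ((d : ℝ) - 2) := Real.rpow_pos_of_pos (by exact_mod_cast hL) _
  by_contra hq
  have hq0 : q1SqT L M (modeS M L i₀) = 0 :=
    le_antisymm (not_lt.1 hq) (sum_nonneg fun c _ => sq_nonneg _)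
  rw [hq0, mul_zero] at h
  linarith

/-! ## §7  (v1.1) The non-exact flat face-crossing mode `modeH`: the side condition `L < M i₀` of §3/§5 is not needed

Credit: the mode and the proofs of this section are the cross-reader's (b2b-balaban-pv04-g18, XREAD of v1, GAPS
C-pv04g18-1, INFO I1; kernel probe `Probe.lean` sha256[:16] 7ab69b701d6219c6 of that seat), adapted to this
namespace.  `modeH L i₀` = 1 on the bonds ⟨x, x + e_{i₀}⟩ that CROSS a block face (`L ∣ x_{i₀} + 1`), 0 elsewhere:
a flat (curl-free) configuration with holonomy `M_{i₀}/L` around the i₀-cycle — not a gradient when `M_{i₀} = L`,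
where every block-constant gradient (`modeS`) vanishes.  It is M-periodic (`L ∣ M_i`), vanishes on every tree
bond, has ∂₁ = 0 and ‖·‖²_T > 0.  [folklore] -/

/-- The face-crossing flat mode: 1 on ⟨x, x + e_{i₀}⟩ iff `L ∣ x_{i₀} + 1` (the bond leaves its block through the
face in direction i₀), 0 on every other bond. [folklore] (cross-reader pv04-g18's witness, v1.1) -/
def modeH (L : ℕ) (i₀ : Fin d) : Cfg d := fun b => if b.2 = i₀ ∧ (L : ℤ) ∣ b.1 i₀ + 1 then 1 else 0

/-- Unfolding lemma for `modeH`. [folklore] -/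
theorem modeH_apply (i₀ : Fin d) (x : Fin d → ℤ) (ν : Fin d) :
    modeH L i₀ (x, ν) = if ν = i₀ ∧ (L : ℤ) ∣ x i₀ + 1 then 1 else 0 := rfl

/-- `modeH` is a configuration on the torus T = ℤ^d/(M) whenever L ∣ M_i. [folklore] -/
theorem isPeriodic_modeH {M : Fin d → ℕ} (hLM : ∀ i, L ∣ M i) (i₀ : Fin d) :
    IsPeriodic M (modeH (d := d) L i₀) := by
  intro x v ν hv
  have hLv : (L : ℤ) ∣ v i₀ := (Int.natCast_dvd_natCast.2 (hLM i₀)).trans (hv i₀)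
  have key : ((L : ℤ) ∣ (x + v) i₀ + 1) ↔ ((L : ℤ) ∣ x i₀ + 1) := by
    rw [Pi.add_apply, add_right_comm]
    exact dvd_add_left hLv
  simp only [modeH_apply, key]

/-- `modeH` is flat: ∂₁ modeH = 0 on every plaquette (it depends on x only through x_{i₀} and lives on i₀-bonds).
[folklore] -/
theorem curl_modeH (i₀ : Fin d) (z : Fin d → ℤ) (j μ : Fin d) : curl (modeH (d := d) L i₀) z j μ = 0 := by
  rw [curl, modeH_apply, modeH_apply, modeH_apply, modeH_apply, add_unitVec_apply, add_unitVec_apply]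
  by_cases hj : j = i₀
  · subst hj
    by_cases hμ : μ = j
    · subst hμ
      simp
    · have hμ' : ¬ j = μ := fun h => hμ h.symm
      simp [hμ, hμ']
  · by_cases hμ : μ = i₀
    · subst hμ
      have hj' : ¬ μ = j := fun h => hj h.symm
      simp [hj, hj']
    · simp [hj, hμ]

/-- Hence the ∂₁-term of (2.128)/(2.118) vanishes at `modeH`: Σ_{p⊂T}|(∂₁ modeH)(p)|² = 0. [folklore] -/
theorem d1SqT_modeH (M : Fin d → ℕ) (i₀ : Fin d) : d1SqT M (modeH (d := d) L i₀) = 0 := by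
  unfold d1SqT
  exact sum_eq_zero fun p _ => by rw [curl_modeH]; ring

/-- Crossing bonds are never tree bonds: `modeH` vanishes on Γ_y for every y ∈ LZ^d, i.e. it satisfies the typed
(2.121) in tree form. [folklore] -/
theorem modeH_treeBonds (hL : 0 < L) (i₀ : Fin d) {y : Fin d → ℤ} (hy : ∀ i, (L : ℤ) ∣ y i) :
    ∀ b ∈ treeBonds L y, modeH L i₀ b = 0 := by
  intro b hb
  obtain ⟨h1, -, h3⟩ := mem_treeBonds.1 hb
  show (if b.2 = i₀ ∧ (L : ℤ) ∣ b.1 i₀ + 1 then (1 : ℝ) else 0) = 0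
  rw [if_neg]
  rintro ⟨hb2, hdvd⟩
  subst hb2
  have hlo := (mem_block.1 h1 b.2).1
  obtain ⟨q, hq⟩ := hy b.2
  obtain ⟨r, hr⟩ := hdvd
  have hLpos : (0 : ℤ) < L := by exact_mod_cast hL
  have e1 : (L : ℤ) * q < (L : ℤ) * r := by rw [← hq, ← hr]; omega
  have e2 : (L : ℤ) * r < (L : ℤ) * (q + 1) := by rw [mul_add, mul_one, ← hq, ← hr]; omega
  have f1 := lt_of_mul_lt_mul_left e1 hLpos.le
  have f2 := lt_of_mul_lt_mul_left e2 hLpos.le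
  omega

/-- … and (2.121) in the printed contour form `B(Γ_{y,x}) = 0`. [folklore] -/
theorem contourSum_modeH (hL : 0 < L) (i₀ : Fin d) {y : Fin d → ℤ} (hy : ∀ i, (L : ℤ) ∣ y i)
    {x : Fin d → ℤ} (hx : x ∈ B6Elimination.block L y) : contourSum L (modeH L i₀) y x = 0 := by
  unfold contourSum
  exact sum_eq_zero fun b hb => modeH_treeBonds hL i₀ hy b (contour_subset_treeBonds hx hb)

/-- The marked crossing bond ⟨zW, zW + e_{i₀}⟩ (zW_{i₀} = L − 1) carries the value 1. [folklore] -/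
theorem modeH_marked (i₀ : Fin d) : modeH L i₀ (zW L i₀, i₀) = 1 := by
  rw [modeH_apply, zW_apply, if_pos rfl, sub_add_cancel, if_pos ⟨rfl, dvd_refl _⟩]

/-- ‖modeH‖²_T > 0 on every torus with L ≥ 1, M_i ≥ 1, L ∣ M_i (the marked bond lies in the period box).
[folklore] -/
theorem normSqT_modeH_pos (hL : 1 ≤ L) {M : Fin d → ℕ} (hM : ∀ i, 0 < M i) (hLM : ∀ i, L ∣ M i)
    (i₀ : Fin d) : 0 < normSqT M (modeH L i₀) :=
  normSqT_pos_of_bond (b := (zW L i₀, i₀)) (mem_bondsT.2 (zW_mem_pbox hL hM hLM))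
    (by rw [modeH_marked]; norm_num)

/-- **(2.128) on T WITHOUT the Q₁-term is false on EVERY torus** — L ≥ 1, M_i ≥ 1, L ∣ M_i, ANY number of blocks
per direction (v1's `lemma24_torus_false_without_q1` needed `L < M i₀`): granting periodicity and the tree gauge
(2.121), `(1/(12d²)) L^{−(d+1)} ‖B‖²_T ≤ Σ_{p⊂T}|(∂₁B)(p)|²` fails at `B = modeH L i₀`.
[cite: Balaban1984PropagatorsII, Lemma 2.4 (2.128) p.245 (locator; typed torus version with one term deleted)]
(cross-reader pv04-g18's theorem `without_q1_allTori`, v1.1) -/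
theorem lemma24_torus_false_without_q1_allTori (hL : 1 ≤ L) {M : Fin d → ℕ} (hM : ∀ i, 0 < M i)
    (hLM : ∀ i, L ∣ M i) (i₀ : Fin d) :
    ¬ ∀ B : Cfg d, IsPeriodic M B → (∀ y ∈ coarseSites L M, ∀ b ∈ treeBonds L y, B b = 0) →
      1 / (12 * (d : ℝ) ^ 2) * (L : ℝ) ^ (-((d : ℝ) + 1)) * normSqT M B ≤ d1SqT M B := by
  intro h
  have h1 := h (modeH L i₀) (isPeriodic_modeH hLM i₀)
    (fun y hy => modeH_treeBonds hL i₀ (coarseSites_dvd y hy))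
  rw [d1SqT_modeH] at h1
  have hd : 0 < d := lt_of_le_of_lt (Nat.zero_le _) i₀.isLt
  have h2 := mul_pos (prefactor_pos (d := d) (L := L) hd hL one_pos) (normSqT_modeH_pos hL hM hLM i₀)
  linarith

/-- **The constraint "QB = 0" of the printed (2.153) sentence is load-bearing on EVERY torus** (v1's
`lowerBound2153_torus_false_without_QB` needed `L < M i₀`): with the admissible `form B := γ₀ Σ_p|(∂₁B)(p)|²` and
γ₀ > 0, dropping "QB = 0" (keeping B(Γ_{y,x}) = 0) is refuted by `modeH L i₀`.
[cite: Balaban1984PropagatorsII, (2.153) p.249 (locator; typed torus version with one constraint deleted)]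
(cross-reader pv04-g18's theorem `lb2153_without_QB_allTori`, v1.1) -/
theorem lowerBound2153_torus_false_without_QB_allTori (hL : 1 ≤ L) {M : Fin d → ℕ} (hM : ∀ i, 0 < M i)
    (hLM : ∀ i, L ∣ M i) (i₀ : Fin d) {γ₀ : ℝ} (hγ : 0 < γ₀) :
    ¬ ∀ form : Cfg d → ℝ, (∀ B : Cfg d, IsPeriodic M B → γ₀ * d1SqT M B ≤ form B) →
      ∀ B : Cfg d, IsPeriodic M B →
        (∀ y ∈ coarseSites L M, ∀ x ∈ B6Elimination.block L y, contourSum L B y x = 0) →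
        γ₀ / (12 * (d : ℝ) ^ 2) * (L : ℝ) ^ (-((d : ℝ) + 1)) * normSqT M B ≤ form B := by
  intro h
  have h1 := h (fun B => γ₀ * d1SqT M B) (fun B _ => le_rfl) (modeH L i₀) (isPeriodic_modeH hLM i₀)
    (fun y hy x hx => contourSum_modeH hL i₀ (coarseSites_dvd y hy) hx)
  simp only [d1SqT_modeH, mul_zero] at h1
  have hd : 0 < d := lt_of_le_of_lt (Nat.zero_le _) i₀.isLt
  have h2 := mul_pos (prefactor_pos (d := d) (L := L) hd hL hγ) (normSqT_modeH_pos hL hM hLM i₀)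
  linarith

/-- The ONE-BLOCK torus d = 4, L = 2, M ≡ 2 (not covered by v1's `L < M i₀`): (2.128) without the Q₁-term still
fails. [folklore] -/
theorem oneBlockTorus_without_q1 :
    ¬ ∀ B : Cfg 4, IsPeriodic (fun _ => 2) B →
      (∀ y ∈ coarseSites 2 (fun _ => (2 : ℕ)), ∀ b ∈ treeBonds 2 y, B b = 0) →
      1 / (12 * ((4 : ℕ) : ℝ) ^ 2) * ((2 : ℕ) : ℝ) ^ (-(((4 : ℕ) : ℝ) + 1)) * normSqT (fun _ => 2) B ≤
        d1SqT (fun _ => 2) B :=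
  lemma24_torus_false_without_q1_allTori (by norm_num) (fun _ => by norm_num) (fun _ => dvd_refl _) 0

end

end Literature.MathematicalPhysics.QuantumFieldTheory.Balaban1983to89.B6Lemma24TorusGaugeModes
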